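import Mathlib.Algebra.Polynomial.Taylor
import Mathlib.Algebra.Polynomial.Div
import Mathlib.Algebra.Polynomial.Eval.Degree
import Mathlib.Tactic.LinearCombination
import Mathlib.Tactic.FieldSimp
import HarnessLib

/-!
# The sextic-to-odd transport of a genus-2 model through a rational Weierstrass point (kind CC 0.4, step T1)

Topic `Literature/Computation/Certificates`; namespace `Literature.Computation.Certificates.SexticOddTransport`.
Kind CC version 0.4 of the certified rational-points stack (`pub/certnum/nt/FORMAT-ratpcert-v0.md` §17.4) treats a
genus-2 curve given by an EVEN-degree model `y² = F(x)`, `deg F = 6`, at a prime where `F` has a simple root `α` in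
the ground field (there: `ℤ_p`, via Hensel): writing `F = (X − α)·G` and `G = Σ_{j ≤ 5} g_j (X − α)^j` (Taylor at
`α`; `g₀ = G(α) = F'(α)`), the change of variables `u = g₀/(x − α)`, `w = g₀²·y/(x − α)³` carries the affine points
with `x ≠ α` onto the affine points with `u ≠ 0` of the ODD model
`w² = f(u) := u⁵ + g₁u⁴ + g₂g₀u³ + g₃g₀²u² + g₄g₀³u + g₅g₀⁴` (monic quintic when `g₀ ≠ 0`). This file proves the
underlying POLYNOMIAL IDENTITY over any field — the one step of kind CC 0.4 that was neither a Lean twin nor a named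
fact (the checker verifies it numerically modulo `p^K` for every transported point):

* `eval_eq_mul_divByMonic` — `F(x) = (x − α)·G(x)` for a root `α`;
* `eval_divByMonic_eq_sum_taylor` — `G(x) = Σ_{j<6} g_j (x − α)^j` when `deg F = 6`;
* **`transport_onCurve`** — `y² = F(x)`, `x ≠ α` ⇒ `w² = f(u)`;
* **`transport_onCurve_iff`** — conversely `w² = f(u)` ⇒ `y² = F(x)` (so the map is a bijection between the two
  affine pieces, its inverse being `x = α + g₀/u`, `y = w·(x − α)³/g₀²` — `transport_leftInverse`).

Elementary algebra (Taylor expansion of polynomials, `Polynomial.sum_taylor_eq`); no named fact.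

## References

* J. S. Balakrishnan, R. W. Bradshaw, K. S. Kedlaya, Explicit Coleman integration for hyperelliptic curves, ANTS IX
  (2010), §1 (odd-degree models `y² = f(x)` as the setting of the algorithms). [BalakrishnanBradshawKedlaya2010]
* E. V. Flynn, B. Poonen, E. F. Schaefer, Cycles of quadratic polynomials and rational points on a genus-2 curve,
  Duke Math. J. 90 (1997), §3 («since f has no rational roots the curve is not birational over ℚ to y² = quintic» —
  the obstruction this transport removes over ℚ_p). [FlynnPoonenSchaefer1997]
-/

namespace Literature.Computation.Certificates.SexticOddTransport

open Polynomial Finset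

variable {k : Type*} [Field k]

/-- `F(x) = (x − α)·G(x)` with `G = F /ₘ (X − C α)` when `α` is a root of `F`.
[cite: BalakrishnanBradshawKedlaya2010, §1 (models)] -/
theorem eval_eq_mul_divByMonic (F : k[X]) {α : k} (hα : F.IsRoot α) (x : k) :
    F.eval x = (x - α) * (F /ₘ (X - C α)).eval x := by
  conv_lhs => rw [← mul_divByMonic_eq_iff_isRoot.2 hα]
  rw [eval_mul, eval_sub, eval_X, eval_C]

/-- Taylor expansion of the cofactor at the root: `G(x) = Σ_{j<6} g_j (x − α)^j`, `g_j = (taylor α G).coeff j`, when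
`deg F = 6` (so `deg G = 5`). [cite: BalakrishnanBradshawKedlaya2010, §1 (models)] -/
theorem eval_divByMonic_eq_sum_taylor (F : k[X]) (α : k) (hdeg : F.natDegree = 6) (x : k) :
    (F /ₘ (X - C α)).eval x = ∑ j ∈ range 6, (taylor α (F /ₘ (X - C α))).coeff j * (x - α) ^ j := by
  set G := F /ₘ (X - C α) with hG
  have hdegG : (taylor α G).natDegree < 6 := by
    rw [natDegree_taylor, hG, natDegree_divByMonic F (monic_X_sub_C α), natDegree_X_sub_C, hdeg]
    norm_num
  have h := taylor_eval α G (x - α)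
  rw [sub_add_cancel] at h
  rw [← h, eval_eq_sum_range' hdegG]

/-- **The transport lands on the odd model.** With `g_j` the Taylor coefficients of `G = F/(X − α)` at the root
`α`, `g₀ = g 0`, `u = g₀/(x − α)`, `w = g₀²y/(x − α)³`: if `y² = F(x)` and `x ≠ α` then
`w² = u⁵ + g₁u⁴ + g₂g₀u³ + g₃g₀²u² + g₄g₀³u + g₅g₀⁴`. [cite: BalakrishnanBradshawKedlaya2010, §1 (models)]
[cite: FlynnPoonenSchaefer1997, §3 (no odd model over ℚ without a rational Weierstrass point)] -/
theorem transport_onCurve (F : k[X]) {α : k} (hα : F.IsRoot α) (hdeg : F.natDegree = 6) {x y : k}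
    (hx : x ≠ α) (hcurve : y ^ 2 = F.eval x) :
    let g : ℕ → k := fun j => (taylor α (F /ₘ (X - C α))).coeff j
    let u : k := g 0 / (x - α)
    let w : k := g 0 ^ 2 * y / (x - α) ^ 3
    w ^ 2 = u ^ 5 + g 1 * u ^ 4 + g 2 * g 0 * u ^ 3 + g 3 * g 0 ^ 2 * u ^ 2 + g 4 * g 0 ^ 3 * u + g 5 * g 0 ^ 4 := by
  intro g u w
  have hxa : x - α ≠ 0 := sub_ne_zero.2 hx
  have hF : F.eval x = (x - α) * ∑ j ∈ range 6, g j * (x - α) ^ j := by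
    rw [eval_eq_mul_divByMonic F hα x, eval_divByMonic_eq_sum_taylor F α hdeg x]
  simp only [u, w]
  rw [div_pow, mul_pow, ← pow_mul, hcurve, hF, Finset.sum_range_succ, Finset.sum_range_succ,
    Finset.sum_range_succ, Finset.sum_range_succ, Finset.sum_range_succ, Finset.sum_range_succ,
    Finset.sum_range_zero]
  field_simp
  ring

/-- **Conversely**, `w² = f(u)` forces `y² = F(x)` (same notation, `x ≠ α`, `g₀ ≠ 0`): the transport is a bijection
between `{(x, y) : y² = F(x), x ≠ α}` and `{(u, w) : w² = f(u), u ≠ 0}`.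
[cite: BalakrishnanBradshawKedlaya2010, §1 (models)] -/
theorem transport_onCurve_iff (F : k[X]) {α : k} (hα : F.IsRoot α) (hdeg : F.natDegree = 6) {x y : k}
    (hx : x ≠ α) (hg0 : (taylor α (F /ₘ (X - C α))).coeff 0 ≠ 0) :
    let g : ℕ → k := fun j => (taylor α (F /ₘ (X - C α))).coeff j
    let u : k := g 0 / (x - α)
    let w : k := g 0 ^ 2 * y / (x - α) ^ 3
    (w ^ 2 = u ^ 5 + g 1 * u ^ 4 + g 2 * g 0 * u ^ 3 + g 3 * g 0 ^ 2 * u ^ 2 + g 4 * g 0 ^ 3 * u + g 5 * g 0 ^ 4)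
      ↔ y ^ 2 = F.eval x := by
  intro g u w
  refine ⟨fun h => ?_, fun h => transport_onCurve F hα hdeg hx h⟩
  have hxa : x - α ≠ 0 := sub_ne_zero.2 hx
  have hF : F.eval x = (x - α) * ∑ j ∈ range 6, g j * (x - α) ^ j := by
    rw [eval_eq_mul_divByMonic F hα x, eval_divByMonic_eq_sum_taylor F α hdeg x]
  rw [hF, Finset.sum_range_succ, Finset.sum_range_succ, Finset.sum_range_succ, Finset.sum_range_succ,
    Finset.sum_range_succ, Finset.sum_range_succ, Finset.sum_range_zero]
  simp only [u, w] at h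
  rw [div_pow, mul_pow, ← pow_mul] at h
  have hg0' : g 0 ≠ 0 := hg0
  field_simp at h
  -- h : (g 0 ^ 2) ^ 2 * y ^ 2 * ... = ... ; isolate y ^ 2
  have hpow : (x - α) ^ 6 ≠ 0 := pow_ne_zero _ hxa
  have key : g 0 ^ 4 * (y ^ 2 - (x - α) * (g 0 + g 1 * (x - α) + g 2 * (x - α) ^ 2 + g 3 * (x - α) ^ 3
      + g 4 * (x - α) ^ 4 + g 5 * (x - α) ^ 5)) = 0 := by
    linear_combination h
  have hg4 : g 0 ^ 4 ≠ 0 := pow_ne_zero _ hg0'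
  have := (mul_eq_zero.1 key).resolve_left hg4
  linear_combination this

/-- The inverse change of variables `x = α + g₀/u`, `y = w(x − α)³/g₀²` undoes the transport (`u, g₀ ≠ 0`).
[cite: BalakrishnanBradshawKedlaya2010, §1 (models)] -/
theorem transport_leftInverse {α g0 u w : k} (hu : u ≠ 0) (hg0 : g0 ≠ 0) :
    let x : k := α + g0 / u
    let y : k := w * (x - α) ^ 3 / g0 ^ 2
    g0 / (x - α) = u ∧ g0 ^ 2 * y / (x - α) ^ 3 = w := by
  intro x y
  have hxa : x - α = g0 / u := by simp [x]
  have hxa0 : x - α ≠ 0 := by rw [hxa]; exact div_ne_zero hg0 hu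
  constructor
  · rw [hxa]; field_simp
  · simp only [y]; field_simp

end Literature.Computation.Certificates.SexticOddTransport
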